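import Mathlib
import HarnessLib
import Summits.NavierStokesRegularity.NavierStokesRegularity.Theorems.PoloidalWindowRigidity.Negative.DriftProfile
import Literature.Algebra.EuclideanLattices.FccBccLattices

/-!
# Crux `PoloidalWindowRigidity` (K2, stmt-NavierStokesRegularity-19708) — negative side:
# the THREE-SHEET poloidal frozen field (kinematics)

Negative-side support (refuter seat ns-regularity-refuter1 gen 2, cell ns-regularity-ideate; D-0081 §C).

The three-wave witness `…Negative.TriWaveProfile` of the negative lane has infinite energy on every slice at the
rate `∫_{B_R} |v|² ~ R³`; a large-scale energy clause at the rate `R²` of the class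
(`…PoloidalWindowDoorPoloidalWindowRigidityLargeScaleEnergy`) would cut it.  This file starts the replacement on
the SAME wave-cone stratum `S = (∂₀φ, ∂₁φ, −∂₂φ)`, `∂₂²φ = Δ_h φ`, with the three plane waves replaced by three
SHEETS of finite cross-section: `φ = F(x₀+x₂) + F(x₁−x₂) − F(x₁+x₂)` with the odd rational bump
`F′ = β`, `β(z) = 2z/(1+z²)⁵`:

  `S = (β(u), β(w) − β(p), −β(u) + β(w) + β(p))`,  `u = x₀+x₂`, `w = x₁−x₂`, `p = x₁+x₂`.

Contents: `oddBump = β`, `oddBumpDeriv = β′ = 2(1−9z²)/(1+z²)⁶` (`hasDerivAt_oddBump`), the bounds `|β| ≤ 1`,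
`|β′| ≤ 2 = β′(0)`, the sharp maximum `β ≤ β(1/3) = 19683/50000 =: bumpMax` with its equality case (the
polynomial identity `19683(1+z²)⁵ − 10⁵ z = (3z−1)²·Q(z)`, `Q > 0` on `z ≥ 0`), the field `sheetField = S` with
explicit derivative `sheetDeriv`, `div S = 0`, `curl S = (2β′(w) + 2β′(p), 2β′(u), 0)` (poloidal along `e₂`),
`‖S‖ ≤ 6`, `‖DS w‖ ≤ 24‖w‖`, `|curl S|² ≤ 80`.  WHAT THIS IS NOT: not a claim about Navier–Stokes — kinematics of
an explicit field; the crux K2 stays open. [folklore]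
-/

noncomputable section

-- the summit and its single sub-problem share the name (CONVENTIONS §1), as in every Theorems file
set_option linter.dupNamespace false

namespace Summit.NavierStokesRegularity.NavierStokesRegularity.Theorems.PoloidalWindowRigidity.Negative

open MeasureTheory Set Function Filter Topology Metric
open scoped RealInnerProductSpace InnerProductSpace ENNReal NNReal
open Literature.Analysis Literature.Analysis.FluidPDE

/-! ## The odd rational bump -/

/-- The odd rational bump `β(z) = 2z/(1+z²)⁵`. [folklore] -/
def oddBump (z : ℝ) : ℝ := 2 * z / (1 + z ^ 2) ^ 5

/-- Its derivative `β′(z) = 2(1 − 9z²)/(1+z²)⁶`. [folklore] -/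
def oddBumpDeriv (z : ℝ) : ℝ := 2 * (1 - 9 * z ^ 2) / (1 + z ^ 2) ^ 6

/-- The maximum `β(1/3) = (2/3)(9/10)⁵ = 19683/50000` of the bump. [folklore] -/
def bumpMax : ℝ := 19683 / 50000

/-- `β` is odd. [folklore] -/
theorem oddBump_neg (z : ℝ) : oddBump (-z) = -oddBump z := by
  unfold oddBump
  rw [neg_sq]
  ring

/-- `β′` is even. [folklore] -/
theorem oddBumpDeriv_neg (z : ℝ) : oddBumpDeriv (-z) = oddBumpDeriv z := by
  unfold oddBumpDeriv
  rw [neg_sq]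

/-- `β(0) = 0`. [folklore] -/
theorem oddBump_zero : oddBump 0 = 0 := by simp [oddBump]

/-- `β′(0) = 2`. [folklore] -/
theorem oddBumpDeriv_zero : oddBumpDeriv 0 = 2 := by norm_num [oddBumpDeriv]

/-- `β′(1/3) = 0`. [folklore] -/
theorem oddBumpDeriv_third : oddBumpDeriv (1 / 3) = 0 := by norm_num [oddBumpDeriv]

/-- `β′(−1/3) = 0`. [folklore] -/
theorem oddBumpDeriv_neg_third : oddBumpDeriv (-(1 / 3)) = 0 := by norm_num [oddBumpDeriv]

/-- `β(1/3) = bumpMax`. [folklore] -/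
theorem oddBump_third : oddBump (1 / 3) = bumpMax := by norm_num [oddBump, bumpMax]

/-- `β(−1/3) = −bumpMax`. [folklore] -/
theorem oddBump_neg_third : oddBump (-(1 / 3)) = -bumpMax := by norm_num [oddBump, bumpMax]

/-- `0 < bumpMax`. [folklore] -/
theorem bumpMax_pos : 0 < bumpMax := by norm_num [bumpMax]

/-- `β` has derivative `β′`. [folklore] -/
theorem hasDerivAt_oddBump (z : ℝ) : HasDerivAt oddBump (oddBumpDeriv z) z := by
  have hnum : HasDerivAt (fun y : ℝ => 2 * y) 2 z := by
    simpa using (hasDerivAt_id z).const_mul (2 : ℝ)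
  have hden : HasDerivAt (fun y : ℝ => (1 + y ^ 2) ^ 5) (5 * (1 + z ^ 2) ^ 4 * (2 * z)) z := by
    have h1 : HasDerivAt (fun y : ℝ => 1 + y ^ 2) (2 * z) z := by
      simpa using ((hasDerivAt_pow 2 z).const_add (1 : ℝ))
    have h5 := h1.fun_pow 5
    simpa using h5
  have hq := hnum.div hden (pow_ne_zero 5 (show (0:ℝ) < 1 + z ^ 2 by positivity).ne')
  have heq : (2 * (1 + z ^ 2) ^ 5 - 2 * z * (5 * (1 + z ^ 2) ^ 4 * (2 * z))) / ((1 + z ^ 2) ^ 5) ^ 2 =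
      oddBumpDeriv z := by
    unfold oddBumpDeriv
    have hp := (show (0:ℝ) < 1 + z ^ 2 by positivity).ne'
    field_simp
    ring
  rw [← heq]
  exact hq

/-- `β` is differentiable. [folklore] -/
theorem differentiable_oddBump : Differentiable ℝ oddBump := fun z => (hasDerivAt_oddBump z).differentiableAt

/-- `β` is continuous. [folklore] -/
theorem continuous_oddBump : Continuous oddBump := differentiable_oddBump.continuous

/-- `β′` is continuous. [folklore] -/
theorem continuous_oddBumpDeriv : Continuous oddBumpDeriv := by
  unfold oddBumpDeriv
  refine Continuous.div (by continuity) (by continuity) fun z =>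
    pow_ne_zero 6 (show (0:ℝ) < 1 + z ^ 2 by positivity).ne'

/-- `|β(z)| ≤ 1` (`2|z| ≤ 1 + z²`). [folklore] -/
theorem abs_oddBump_le_one (z : ℝ) : |oddBump z| ≤ 1 := by
  unfold oddBump
  have hp := (show (0:ℝ) < 1 + z ^ 2 by positivity)
  rw [abs_div, abs_of_pos (pow_pos hp 5), div_le_one (pow_pos hp 5), abs_mul, abs_two]
  have h1 : 2 * |z| ≤ 1 + z ^ 2 := by nlinarith [sq_nonneg (|z| - 1), sq_abs z]
  have h2 : (1 : ℝ) + z ^ 2 ≤ (1 + z ^ 2) ^ 5 := by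
    have : (1 : ℝ) ≤ 1 + z ^ 2 := by nlinarith [sq_nonneg z]
    calc (1 : ℝ) + z ^ 2 = (1 + z ^ 2) ^ 1 := (pow_one _).symm
      _ ≤ (1 + z ^ 2) ^ 5 := pow_le_pow_right₀ this (by norm_num)
  linarith

/-- `|β′(z)| ≤ 2` (`|1 − 9z²| ≤ 1 + 6z² + 15z⁴ ≤ (1+z²)⁶`). [folklore] -/
theorem abs_oddBumpDeriv_le_two (z : ℝ) : |oddBumpDeriv z| ≤ 2 := by
  unfold oddBumpDeriv
  have hp := (show (0:ℝ) < 1 + z ^ 2 by positivity)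
  rw [abs_div, abs_of_pos (pow_pos hp 6), div_le_iff₀ (pow_pos hp 6), abs_mul, abs_two]
  have h6 : (1 : ℝ) + 6 * z ^ 2 + 15 * z ^ 4 ≤ (1 + z ^ 2) ^ 6 := by
    nlinarith [sq_nonneg z, sq_nonneg (z ^ 2), sq_nonneg (z ^ 3), pow_pos hp 3, sq_nonneg (z * (1 + z ^ 2))]
  have habs : |1 - 9 * z ^ 2| ≤ 1 + 6 * z ^ 2 + 15 * z ^ 4 := by
    rw [abs_le]
    constructor <;> nlinarith [sq_nonneg z, sq_nonneg (z ^ 2)]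
  nlinarith

/-- **Sharp maximum of the bump**: `β(z) ≤ bumpMax`, by the polynomial identity
`19683(1+z²)⁵ − 10⁵ z = (3z−1)² Q(z)` with `Q > 0` on `z ≥ 0`. [folklore] -/
theorem oddBump_le_bumpMax (z : ℝ) : oddBump z ≤ bumpMax := by
  unfold oddBump bumpMax
  have hp := (show (0:ℝ) < 1 + z ^ 2 by positivity)
  rw [div_le_div_iff₀ (pow_pos hp 5) (by norm_num : (0 : ℝ) < 50000)]
  rcases le_or_gt 0 z with hz | hz
  · have key : 19683 * (1 + z ^ 2) ^ 5 - 100000 * z = (3 * z - 1) ^ 2 * (2187 * z ^ 8 + 1458 * z ^ 7 +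
        11664 * z ^ 6 + 7614 * z ^ 5 + 25650 * z ^ 4 + 16254 * z ^ 3 + 29856 * z ^ 2 + 18098 * z + 19683) := by
      ring
    have hQ : 0 ≤ (3 * z - 1) ^ 2 * (2187 * z ^ 8 + 1458 * z ^ 7 + 11664 * z ^ 6 + 7614 * z ^ 5 + 25650 * z ^ 4 +
        16254 * z ^ 3 + 29856 * z ^ 2 + 18098 * z + 19683) := by positivity
    nlinarith
  · nlinarith [pow_pos hp 5]

/-- Equality case: `β(z) = bumpMax ↔ z = 1/3`. [folklore] -/
theorem oddBump_eq_bumpMax_iff (z : ℝ) : oddBump z = bumpMax ↔ z = 1 / 3 := by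
  constructor
  · intro h
    unfold oddBump bumpMax at h
    have hp := (show (0:ℝ) < 1 + z ^ 2 by positivity)
    rw [div_eq_div_iff (pow_ne_zero 5 hp.ne') (by norm_num : (50000 : ℝ) ≠ 0)] at h
    rcases le_or_gt 0 z with hz | hz
    · have key : 19683 * (1 + z ^ 2) ^ 5 - 100000 * z = (3 * z - 1) ^ 2 * (2187 * z ^ 8 + 1458 * z ^ 7 +
          11664 * z ^ 6 + 7614 * z ^ 5 + 25650 * z ^ 4 + 16254 * z ^ 3 + 29856 * z ^ 2 + 18098 * z + 19683) := by
        ring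
      have hQpos : 0 < 2187 * z ^ 8 + 1458 * z ^ 7 + 11664 * z ^ 6 + 7614 * z ^ 5 + 25650 * z ^ 4 +
          16254 * z ^ 3 + 29856 * z ^ 2 + 18098 * z + 19683 := by positivity
      have h0 : (3 * z - 1) ^ 2 * (2187 * z ^ 8 + 1458 * z ^ 7 + 11664 * z ^ 6 + 7614 * z ^ 5 + 25650 * z ^ 4 +
          16254 * z ^ 3 + 29856 * z ^ 2 + 18098 * z + 19683) = 0 := by rw [← key]; linarith
      rcases mul_eq_zero.1 h0 with h1 | h1
      · have := pow_eq_zero_iff (n := 2) (by norm_num) |>.1 h1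
        linarith
      · exact absurd h1 hQpos.ne'
    · nlinarith [pow_pos hp 5]
  · rintro rfl
    exact oddBump_third

/-- `−bumpMax ≤ β(z)`. [folklore] -/
theorem neg_bumpMax_le_oddBump (z : ℝ) : -bumpMax ≤ oddBump z := by
  have h := oddBump_le_bumpMax (-z)
  rw [oddBump_neg] at h
  linarith

/-- Equality case: `β(z) = −bumpMax ↔ z = −1/3`. [folklore] -/
theorem oddBump_eq_neg_bumpMax_iff (z : ℝ) : oddBump z = -bumpMax ↔ z = -(1 / 3) := by
  have h := oddBump_eq_bumpMax_iff (-z)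
  rw [oddBump_neg, neg_eq_iff_eq_neg] at h
  rw [h]
  constructor <;> intro h1 <;> linarith

/-- `|β(z)| ≤ bumpMax`. [folklore] -/
theorem abs_oddBump_le_bumpMax (z : ℝ) : |oddBump z| ≤ bumpMax :=
  abs_le.2 ⟨neg_bumpMax_le_oddBump z, oddBump_le_bumpMax z⟩

/-! ## The three-sheet field -/

/-- The three-sheet poloidal field `S = (β(x₀+x₂), β(x₁−x₂) − β(x₁+x₂), −β(x₀+x₂) + β(x₁−x₂) + β(x₁+x₂))`.
[folklore] -/
def sheetField (x : EuclideanSpace ℝ (Fin 3)) : EuclideanSpace ℝ (Fin 3) :=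
  (oddBump (x 0 + x 2)) • (EuclideanSpace.single (0 : Fin 3) (1 : ℝ)) +
    (oddBump (x 1 - x 2) - oddBump (x 1 + x 2)) • (EuclideanSpace.single (1 : Fin 3) (1 : ℝ)) +
    (-(oddBump (x 0 + x 2)) + oddBump (x 1 - x 2) + oddBump (x 1 + x 2)) • (EuclideanSpace.single (2 : Fin 3) (1 : ℝ))

/-- The derivative `DS(x)` as an explicit continuous linear map. [folklore] -/
def sheetDeriv (x : EuclideanSpace ℝ (Fin 3)) : EuclideanSpace ℝ (Fin 3) →L[ℝ] EuclideanSpace ℝ (Fin 3) :=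
  (oddBumpDeriv (x 0 + x 2) • ((EuclideanSpace.proj (𝕜 := ℝ) (0 : Fin 3) : EuclideanSpace ℝ (Fin 3) →L[ℝ] ℝ) +
      (EuclideanSpace.proj (𝕜 := ℝ) (2 : Fin 3) : EuclideanSpace ℝ (Fin 3) →L[ℝ] ℝ))).smulRight
      (EuclideanSpace.single (0 : Fin 3) (1 : ℝ)) +
  (oddBumpDeriv (x 1 - x 2) • ((EuclideanSpace.proj (𝕜 := ℝ) (1 : Fin 3) : EuclideanSpace ℝ (Fin 3) →L[ℝ] ℝ) -
      (EuclideanSpace.proj (𝕜 := ℝ) (2 : Fin 3) : EuclideanSpace ℝ (Fin 3) →L[ℝ] ℝ)) -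
    oddBumpDeriv (x 1 + x 2) • ((EuclideanSpace.proj (𝕜 := ℝ) (1 : Fin 3) : EuclideanSpace ℝ (Fin 3) →L[ℝ] ℝ) +
      (EuclideanSpace.proj (𝕜 := ℝ) (2 : Fin 3) : EuclideanSpace ℝ (Fin 3) →L[ℝ] ℝ))).smulRight
      (EuclideanSpace.single (1 : Fin 3) (1 : ℝ)) +
  (-(oddBumpDeriv (x 0 + x 2) • ((EuclideanSpace.proj (𝕜 := ℝ) (0 : Fin 3) : EuclideanSpace ℝ (Fin 3) →L[ℝ] ℝ) +
      (EuclideanSpace.proj (𝕜 := ℝ) (2 : Fin 3) : EuclideanSpace ℝ (Fin 3) →L[ℝ] ℝ))) +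
    oddBumpDeriv (x 1 - x 2) • ((EuclideanSpace.proj (𝕜 := ℝ) (1 : Fin 3) : EuclideanSpace ℝ (Fin 3) →L[ℝ] ℝ) -
      (EuclideanSpace.proj (𝕜 := ℝ) (2 : Fin 3) : EuclideanSpace ℝ (Fin 3) →L[ℝ] ℝ)) +
    oddBumpDeriv (x 1 + x 2) • ((EuclideanSpace.proj (𝕜 := ℝ) (1 : Fin 3) : EuclideanSpace ℝ (Fin 3) →L[ℝ] ℝ) +
      (EuclideanSpace.proj (𝕜 := ℝ) (2 : Fin 3) : EuclideanSpace ℝ (Fin 3) →L[ℝ] ℝ))).smulRight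
      (EuclideanSpace.single (2 : Fin 3) (1 : ℝ))

/-- `S` is differentiable with derivative `sheetDeriv`. [folklore] -/
theorem hasFDerivAt_sheetField (x : EuclideanSpace ℝ (Fin 3)) : HasFDerivAt sheetField (sheetDeriv x) x := by
  have h0 : HasFDerivAt (fun y : EuclideanSpace ℝ (Fin 3) => y 0)
      (EuclideanSpace.proj (𝕜 := ℝ) (0 : Fin 3) : EuclideanSpace ℝ (Fin 3) →L[ℝ] ℝ) x :=
    (EuclideanSpace.proj (𝕜 := ℝ) (0 : Fin 3)).hasFDerivAt
  have h1 : HasFDerivAt (fun y : EuclideanSpace ℝ (Fin 3) => y 1)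
      (EuclideanSpace.proj (𝕜 := ℝ) (1 : Fin 3) : EuclideanSpace ℝ (Fin 3) →L[ℝ] ℝ) x :=
    (EuclideanSpace.proj (𝕜 := ℝ) (1 : Fin 3)).hasFDerivAt
  have h2 : HasFDerivAt (fun y : EuclideanSpace ℝ (Fin 3) => y 2)
      (EuclideanSpace.proj (𝕜 := ℝ) (2 : Fin 3) : EuclideanSpace ℝ (Fin 3) →L[ℝ] ℝ) x :=
    (EuclideanSpace.proj (𝕜 := ℝ) (2 : Fin 3)).hasFDerivAt
  have hu := (hasDerivAt_oddBump (x 0 + x 2)).comp_hasFDerivAt x (h0.add h2)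
  have hw := (hasDerivAt_oddBump (x 1 - x 2)).comp_hasFDerivAt x (h1.sub h2)
  have hp := (hasDerivAt_oddBump (x 1 + x 2)).comp_hasFDerivAt x (h1.add h2)
  have B := hw.sub hp
  have C := (hu.neg.add hw).add hp
  exact ((hu.smul_const _).add (B.smul_const _)).add (C.smul_const _)

/-- `DS = sheetDeriv`. [folklore] -/
theorem fderiv_sheetField (x : EuclideanSpace ℝ (Fin 3)) : fderiv ℝ sheetField x = sheetDeriv x :=
  (hasFDerivAt_sheetField x).fderiv

/-- `S` is differentiable. [folklore] -/
theorem differentiable_sheetField : Differentiable ℝ sheetField := fun x =>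
  (hasFDerivAt_sheetField x).differentiableAt

/-- `S` is continuous. [folklore] -/
theorem continuous_sheetField : Continuous sheetField := differentiable_sheetField.continuous

/-- The first component of `S`. [folklore] -/
theorem sheetField_apply_zero (x : EuclideanSpace ℝ (Fin 3)) : sheetField x 0 = oddBump (x 0 + x 2) := by
  simp [sheetField]

/-- The second component of `S`. [folklore] -/
theorem sheetField_apply_one (x : EuclideanSpace ℝ (Fin 3)) :
    sheetField x 1 = oddBump (x 1 - x 2) - oddBump (x 1 + x 2) := by
  simp [sheetField]

/-- The third component of `S`. [folklore] -/
theorem sheetField_apply_two (x : EuclideanSpace ℝ (Fin 3)) :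
    sheetField x 2 = -(oddBump (x 0 + x 2)) + oddBump (x 1 - x 2) + oddBump (x 1 + x 2) := by
  simp [sheetField]

/-- The first component of `DS(x) w`. [folklore] -/
theorem sheetDeriv_apply_zero (x w : EuclideanSpace ℝ (Fin 3)) :
    sheetDeriv x w 0 = oddBumpDeriv (x 0 + x 2) * (w 0 + w 2) := by
  simp [sheetDeriv]
  ring

/-- The second component of `DS(x) w`. [folklore] -/
theorem sheetDeriv_apply_one (x w : EuclideanSpace ℝ (Fin 3)) : sheetDeriv x w 1 =
    oddBumpDeriv (x 1 - x 2) * (w 1 - w 2) - oddBumpDeriv (x 1 + x 2) * (w 1 + w 2) := by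
  simp [sheetDeriv]
  ring

/-- The third component of `DS(x) w`. [folklore] -/
theorem sheetDeriv_apply_two (x w : EuclideanSpace ℝ (Fin 3)) : sheetDeriv x w 2 =
    -(oddBumpDeriv (x 0 + x 2) * (w 0 + w 2)) + oddBumpDeriv (x 1 - x 2) * (w 1 - w 2) +
      oddBumpDeriv (x 1 + x 2) * (w 1 + w 2) := by
  simp [sheetDeriv]
  ring

/-- **The vorticity of the three-sheet field**: `curl S = (2β′(w) + 2β′(p), 2β′(u), 0)` — poloidal along `e₂`.
[folklore] -/
theorem curl_sheetField (x : EuclideanSpace ℝ (Fin 3)) : curl sheetField x =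
    (2 * oddBumpDeriv (x 1 - x 2) + 2 * oddBumpDeriv (x 1 + x 2)) • (EuclideanSpace.single (0 : Fin 3) (1 : ℝ)) +
      (2 * oddBumpDeriv (x 0 + x 2)) • (EuclideanSpace.single (1 : Fin 3) (1 : ℝ)) := by
  ext i
  fin_cases i <;>
    simp [curl, fderiv_sheetField, sheetDeriv_apply_zero, sheetDeriv_apply_one, sheetDeriv_apply_two] <;> ring

/-- `div S = 0`. [folklore] -/
theorem sheetDeriv_trace (x : EuclideanSpace ℝ (Fin 3)) :
    sheetDeriv x (EuclideanSpace.single (0 : Fin 3) (1 : ℝ)) 0 +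
      sheetDeriv x (EuclideanSpace.single (1 : Fin 3) (1 : ℝ)) 1 +
      sheetDeriv x (EuclideanSpace.single (2 : Fin 3) (1 : ℝ)) 2 = 0 := by
  rw [sheetDeriv_apply_zero, sheetDeriv_apply_one, sheetDeriv_apply_two]
  simp
  ring

/-! ## Bounds -/

/-- `‖S(x)‖ ≤ 6`. [folklore] -/
theorem norm_sheetField_le (x : EuclideanSpace ℝ (Fin 3)) : ‖sheetField x‖ ≤ 6 := by
  have ha := abs_oddBump_le_one (x 0 + x 2)
  have hb := abs_oddBump_le_one (x 1 - x 2)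
  have hc := abs_oddBump_le_one (x 1 + x 2)
  have e0 : ‖(EuclideanSpace.single (0 : Fin 3) (1 : ℝ) : EuclideanSpace ℝ (Fin 3))‖ = 1 := by simp
  have e1 : ‖(EuclideanSpace.single (1 : Fin 3) (1 : ℝ) : EuclideanSpace ℝ (Fin 3))‖ = 1 := by simp
  have e2 : ‖(EuclideanSpace.single (2 : Fin 3) (1 : ℝ) : EuclideanSpace ℝ (Fin 3))‖ = 1 := by simp
  unfold sheetField
  refine (norm_add_le _ _).trans ?_
  refine (add_le_add (norm_add_le _ _) le_rfl).trans ?_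
  rw [norm_smul, norm_smul, norm_smul, e0, e1, e2, mul_one, mul_one, mul_one, Real.norm_eq_abs,
    Real.norm_eq_abs, Real.norm_eq_abs]
  have h2 : |oddBump (x 1 - x 2) - oddBump (x 1 + x 2)| ≤ 2 := by
    refine (abs_sub _ _).trans ?_
    linarith
  have h3 : |-(oddBump (x 0 + x 2)) + oddBump (x 1 - x 2) + oddBump (x 1 + x 2)| ≤ 3 := by
    refine (abs_add_le _ _).trans ?_
    refine (add_le_add (abs_add_le _ _) le_rfl).trans ?_
    rw [abs_neg]
    linarith
  linarith

/-- `|β′(a) · b| ≤ 2|b|`. [folklore] -/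
theorem abs_oddBumpDeriv_mul_le (a b : ℝ) : |oddBumpDeriv a * b| ≤ 2 * |b| := by
  rw [abs_mul]
  exact mul_le_mul_of_nonneg_right (abs_oddBumpDeriv_le_two a) (abs_nonneg b)

/-- Pointwise bound for the derivative: `‖DS(x) w‖ ≤ 24‖w‖`. [folklore] -/
theorem norm_sheetDeriv_apply_le (x w : EuclideanSpace ℝ (Fin 3)) : ‖sheetDeriv x w‖ ≤ 24 * ‖w‖ := by
  have hw : ∀ i : Fin 3, |w i| ≤ ‖w‖ := by
    intro i
    have := PiLp.norm_apply_le w i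
    rwa [Real.norm_eq_abs] at this
  have hv : sheetDeriv x w = (sheetDeriv x w 0) • (EuclideanSpace.single (0 : Fin 3) (1 : ℝ)) +
      (sheetDeriv x w 1) • (EuclideanSpace.single (1 : Fin 3) (1 : ℝ)) +
      (sheetDeriv x w 2) • (EuclideanSpace.single (2 : Fin 3) (1 : ℝ)) := by
    ext i
    fin_cases i <;> simp
  have e0 : ‖(EuclideanSpace.single (0 : Fin 3) (1 : ℝ) : EuclideanSpace ℝ (Fin 3))‖ = 1 := by simp
  have e1 : ‖(EuclideanSpace.single (1 : Fin 3) (1 : ℝ) : EuclideanSpace ℝ (Fin 3))‖ = 1 := by simp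
  have e2 : ‖(EuclideanSpace.single (2 : Fin 3) (1 : ℝ) : EuclideanSpace ℝ (Fin 3))‖ = 1 := by simp
  rw [hv]
  refine (norm_add_le _ _).trans ?_
  refine (add_le_add (norm_add_le _ _) le_rfl).trans ?_
  rw [norm_smul, norm_smul, norm_smul, e0, e1, e2, mul_one, mul_one, mul_one, Real.norm_eq_abs,
    Real.norm_eq_abs, Real.norm_eq_abs, sheetDeriv_apply_zero, sheetDeriv_apply_one, sheetDeriv_apply_two]
  have hA : |oddBumpDeriv (x 0 + x 2) * (w 0 + w 2)| ≤ 2 * (|w 0| + |w 2|) :=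
    (abs_oddBumpDeriv_mul_le _ _).trans (by linarith [abs_add_le (w 0) (w 2)])
  have hB1 : |oddBumpDeriv (x 1 - x 2) * (w 1 - w 2)| ≤ 2 * (|w 1| + |w 2|) :=
    (abs_oddBumpDeriv_mul_le _ _).trans (by linarith [abs_sub (w 1) (w 2)])
  have hB2 : |oddBumpDeriv (x 1 + x 2) * (w 1 + w 2)| ≤ 2 * (|w 1| + |w 2|) :=
    (abs_oddBumpDeriv_mul_le _ _).trans (by linarith [abs_add_le (w 1) (w 2)])
  have hc1 : |oddBumpDeriv (x 1 - x 2) * (w 1 - w 2) - oddBumpDeriv (x 1 + x 2) * (w 1 + w 2)| ≤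
      4 * (|w 1| + |w 2|) :=
    (abs_sub _ _).trans (by linarith)
  have hc2 : |-(oddBumpDeriv (x 0 + x 2) * (w 0 + w 2)) + oddBumpDeriv (x 1 - x 2) * (w 1 - w 2) +
      oddBumpDeriv (x 1 + x 2) * (w 1 + w 2)| ≤ 2 * (|w 0| + |w 2|) + 4 * (|w 1| + |w 2|) := by
    refine (abs_add_le _ _).trans ?_
    refine (add_le_add (abs_add_le _ _) le_rfl).trans ?_
    rw [abs_neg]
    linarith
  have h0 := hw 0
  have h1 := hw 1
  have h2 := hw 2
  linarith [abs_nonneg (w 0), abs_nonneg (w 1), abs_nonneg (w 2)]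

/-- `|curl S|² ≤ 80`. [folklore] -/
theorem curl_sheetField_sq_le (x : EuclideanSpace ℝ (Fin 3)) :
    (2 * oddBumpDeriv (x 1 - x 2) + 2 * oddBumpDeriv (x 1 + x 2)) ^ 2 + (2 * oddBumpDeriv (x 0 + x 2)) ^ 2 ≤ 80 := by
  have h0 := abs_le.1 (abs_oddBumpDeriv_le_two (x 0 + x 2))
  have h1 := abs_le.1 (abs_oddBumpDeriv_le_two (x 1 - x 2))
  have h2 := abs_le.1 (abs_oddBumpDeriv_le_two (x 1 + x 2))
  nlinarith

end Summit.NavierStokesRegularity.NavierStokesRegularity.Theorems.PoloidalWindowRigidity.Negative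

end
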